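import Literature.Analysis.SegalBargmann.HermiteOrthonormalEuclidean
import HarnessLib

/-!
# Multiplication by `x_j` and by `1 + |x|²` on the Hermite functions (Folland 1989, §1.7 (1.82))

Topic `Analysis/SegalBargmann`; namespace `Literature.Analysis.SegalBargmann`.  Continuation of
`Literature.Analysis.SegalBargmann.HermiteOrthonormalEuclidean`.  The coordinate multiplication operator is the
symmetrised ladder, `x_j = ½(Z_j + Z_j^*)`, so by Folland's ladder (1.82) it moves a Hermite function to its two
neighbours with coefficients of size `O(√|α|)`:

* `coordMulCLM_eq_half_ladder : x_j f = ½(Z_j f + Z_j^* f)` on all of `𝓢(ℝ^σ, ℂ)`;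
* `coordMulCLM_herm : x_j h_α = ½√((α_j+1)/π) · h_{α+1_j} + ½√(α_j/π) · h_{α−1_j}` and its Hermite coefficients;
* the SECOND MOMENTS `⟨x_j h_α, x_j h_α⟩ = (2α_j + 1)/(4π)` (`bpair_coordMulCLM_herm_self`) — orthonormality of the two
  neighbours — and the weight operator `oneAddNormSqCLM = 1 + Σ_j x_j²`, `(oneAddNormSqCLM f)(x) = (1 + ‖x‖²) f(x)`, with
  `⟨h_α, (1+|x|²) h_α⟩ = 1 + Σ_j (2α_j+1)/(4π) = 1 + (2|α| + |σ|)/(4π)`: the diagonal matrix coefficient of the weight grows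
  LINEARLY in `|α|`.

These are the algebraic inputs of the weighted-`L²` growth bounds `‖(1+|x|²)^m h_α‖₂ ≤ C_m (1+|α|)^m`, which with
`HermiteSupNormL1` give polynomial sup-norm bounds for the Hermite functions (the hard half of the `N`-representation
theorem for `𝒮(ℝⁿ)`).  Everything is proved from Mathlib and the imported tree files; no cited fact is used as a
hypothesis.

## References

* G. B. Folland, *Harmonic Analysis in Phase Space*, Annals of Mathematics Studies 122, Princeton UP (1989), §1.7,
  (1.82).  [cite: Folland1989, (1.82)]

## Provenance

Written for the tree under the LEAN-IN-TREE rule (2026-08-18) by the pub-hodgecm formalisation cell (model-construction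
sub-cell, seat mc-binder-2).
-/

set_option autoImplicit false

noncomputable section

open MvPolynomial Complex SchwartzMap MeasureTheory
open scoped BigOperators Real

namespace Literature.Analysis.SegalBargmann

variable {σ : Type*} [Fintype σ] [DecidableEq σ]

/-! ## §1  `x_j = ½(Z_j + Z_j^*)` and its action on `h_α` -/

section Coordinate

/-- **`x_j = ½(Z_j + Z_j^*)`** as operators on `𝓢(ℝ^σ, ℂ)` (`Z_j = X_j + iD_j`, `Z_j^* = X_j − iD_j`). [folklore] -/
theorem coordMulCLM_eq_half_ladder (j : σ) (f : 𝓢(EuclideanSpace ℝ σ, ℂ)) :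
    coordMulCLM j f = (1 / 2 : ℂ) • (zCLM j f + zsCLM j f) := by
  have hz : zCLM j f = coordMulCLM j f + I • opDCLM j f := rfl
  have hzs : zsCLM j f = coordMulCLM j f - I • opDCLM j f := rfl
  rw [hz, hzs, add_add_sub_cancel, ← two_smul ℂ (coordMulCLM j f), smul_smul]
  norm_num

/-- **`x_j h_α = ½√((α_j+1)/π) h_{α+1_j} + ½√(α_j/π) h_{α−1_j}`** (Folland (1.82) symmetrised; the second coefficient
vanishes when `α_j = 0`). [cite: Folland1989, (1.82)] -/
theorem coordMulCLM_herm (j : σ) (α : σ →₀ ℕ) :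
    coordMulCLM j (hermiteSchwartz (herm α)) =
      ((1 / 2 : ℂ) * (Real.sqrt ((α j + 1) / π) : ℂ)) • hermiteSchwartz (herm (α + Finsupp.single j 1)) +
        ((1 / 2 : ℂ) * (Real.sqrt (α j / π) : ℂ)) • hermiteSchwartz (herm (α - Finsupp.single j 1)) := by
  rw [coordMulCLM_eq_half_ladder, zCLM_herm, zsCLM_herm, smul_add, smul_smul, smul_smul, add_comm]

/-- The Hermite coefficients of `x_j h_α`: `c_β(x_j h_α) = ½√((α_j+1)/π) δ_{β,α+1_j} + ½√(α_j/π) δ_{β,α−1_j}`. [folklore] -/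
theorem hermiteCoeff_coordMulCLM_herm (j : σ) (α β : σ →₀ ℕ) :
    hermiteCoeff β (coordMulCLM j (hermiteSchwartz (herm α))) =
      (if β = α + Finsupp.single j 1 then (1 / 2 : ℂ) * (Real.sqrt ((α j + 1) / π) : ℂ) else 0) +
        (if β = α - Finsupp.single j 1 then (1 / 2 : ℂ) * (Real.sqrt (α j / π) : ℂ) else 0) := by
  rw [coordMulCLM_herm, hermiteCoeff_add, hermiteCoeff_smul, hermiteCoeff_smul, hermiteCoeff_herm, hermiteCoeff_herm]
  split_ifs <;> simp

omit [Fintype σ] [DecidableEq σ] in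
/-- The two neighbours `α + 1_j` and `α − 1_j` are distinct multi-indices. [folklore] -/
theorem add_single_ne_sub_single (α : σ →₀ ℕ) (j : σ) :
    α + Finsupp.single j 1 ≠ α - Finsupp.single j 1 := by
  intro h
  have hj := DFunLike.congr_fun h j
  simp only [Finsupp.coe_add, Pi.add_apply, Finsupp.single_eq_same, Finsupp.tsub_apply] at hj
  omega

/-- **Second moments**: `⟨x_j h_α, x_j h_α⟩ = ∫ x_j² h_α² = (α_j + 1)/(4π) + α_j/(4π) = (2α_j+1)/(4π)` (orthonormality of
the two neighbours `h_{α±1_j}`). [cite: Folland1989, §1.7] -/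
theorem bpair_coordMulCLM_herm_self (j : σ) (α : σ →₀ ℕ) :
    bpair (coordMulCLM j (hermiteSchwartz (herm α))) (coordMulCLM j (hermiteSchwartz (herm α))) =
      ((2 * (α j : ℝ) + 1) / (4 * π) : ℝ) := by
  have hne := add_single_ne_sub_single α j
  have h1 : (0 : ℝ) ≤ ((α j : ℝ) + 1) / π := by positivity
  have h2 : (0 : ℝ) ≤ (α j : ℝ) / π := by positivity
  have hs1 : (Real.sqrt (((α j : ℝ) + 1) / π) : ℂ) * (Real.sqrt (((α j : ℝ) + 1) / π) : ℂ) =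
      ((α j : ℂ) + 1) / (π : ℂ) := by
    rw [← Complex.ofReal_mul, Real.mul_self_sqrt h1]
    push_cast
    ring
  have hs2 : (Real.sqrt ((α j : ℝ) / π) : ℂ) * (Real.sqrt ((α j : ℝ) / π) : ℂ) = (α j : ℂ) / (π : ℂ) := by
    rw [← Complex.ofReal_mul, Real.mul_self_sqrt h2]
    push_cast
    ring
  rw [coordMulCLM_herm, bpair_add_left, bpair_add_right, bpair_add_right]
  simp only [bpair_smul_left, bpair_smul_right, bpair_herm_herm, if_neg hne, if_neg (Ne.symm hne),
    mul_zero, add_zero, zero_add]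
  push_cast
  linear_combination (1 / 4 : ℂ) * hs1 + (1 / 4 : ℂ) * hs2

end Coordinate

/-! ## §2  The weight `1 + |x|²` -/

section Weight

/-- **The weight operator `1 + |x|² = 1 + Σ_j x_j²`** on `𝓢(ℝ^σ, ℂ)`. [folklore] -/
def oneAddNormSqCLM : 𝓢(EuclideanSpace ℝ σ, ℂ) →L[ℂ] 𝓢(EuclideanSpace ℝ σ, ℂ) :=
  ContinuousLinearMap.id ℂ _ + ∑ j : σ, (coordMulCLM j).comp (coordMulCLM j)

omit [DecidableEq σ] in
/-- `(1 + |x|²) f (x) = (1 + ‖x‖²) · f(x)`. [folklore] -/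
theorem oneAddNormSqCLM_apply (f : 𝓢(EuclideanSpace ℝ σ, ℂ)) (x : EuclideanSpace ℝ σ) :
    oneAddNormSqCLM f x = ((1 + ‖x‖ ^ 2 : ℝ) : ℂ) * f x := by
  have h1 : oneAddNormSqCLM f x = f x + ∑ j : σ, ((coordMulCLM j).comp (coordMulCLM j)) f x := by
    rw [oneAddNormSqCLM, add_apply, add_apply, ContinuousLinearMap.id_apply, sum_apply, sum_apply]
  have h : ∀ j : σ, ((coordMulCLM j).comp (coordMulCLM j)) f x = ((x j : ℝ) : ℂ) ^ 2 * f x := fun j => by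
    rw [ContinuousLinearMap.comp_apply, coordMulCLM_apply, coordMulCLM_apply]
    ring
  rw [h1, Finset.sum_congr rfl fun j _ => h j, ← Finset.sum_mul, EuclideanSpace.real_norm_sq_eq]
  push_cast
  ring

/-- **The diagonal matrix coefficient of the weight**: `⟨h_α, (1 + |x|²) h_α⟩ = 1 + Σ_j (2α_j+1)/(4π)` — it grows
LINEARLY in `|α|` (`= 1 + (2|α| + |σ|)/(4π)`). [cite: Folland1989, §1.7] -/
theorem bpair_herm_oneAddNormSqCLM_herm (α : σ →₀ ℕ) :
    bpair (hermiteSchwartz (herm α)) (oneAddNormSqCLM (hermiteSchwartz (herm α))) =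
      1 + ∑ j : σ, (((2 * (α j : ℝ) + 1) / (4 * π) : ℝ) : ℂ) := by
  have h1 : oneAddNormSqCLM (hermiteSchwartz (herm α)) = hermiteSchwartz (herm α) +
      ∑ j : σ, coordMulCLM j (coordMulCLM j (hermiteSchwartz (herm α))) := by
    rw [oneAddNormSqCLM, add_apply, ContinuousLinearMap.id_apply, sum_apply]
    rfl
  rw [h1, bpair_add_right, bpair_herm_herm, if_pos rfl, bpair_sum_right]
  congr 1
  refine Finset.sum_congr rfl fun j _ => ?_
  rw [bpair_coordMulCLM, bpair_coordMulCLM_herm_self]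

end Weight

end Literature.Analysis.SegalBargmann

end
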